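import Literature.MathematicalPhysics.QuantumFieldTheory.Balaban1983to89.Node00.Carriers3
import Literature.MathematicalPhysics.QuantumFieldTheory.Balaban1983to89.Node00.Carriers2Frame
import Literature.MathematicalPhysics.QuantumFieldTheory.Balaban1983to89.Node00.B7GaugeGroup
import Literature.MathematicalPhysics.QuantumFieldTheory.Balaban1983to89.Node00.NonVacuityTheta
import Literature.MathematicalPhysics.QuantumFieldTheory.Balaban1983to89.Node00.Satisfiable
import Literature.MathematicalPhysics.QuantumFieldTheory.Balaban1983to89.Node00.N02Dossier
import Literature.MathematicalPhysics.QuantumFieldTheory.Balaban1983to89.B7ConclSubgroup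
import Literature.MathematicalPhysics.QuantumFieldTheory.Balaban1983to89.B7Prop3to7Local
import Literature.MathematicalPhysics.QuantumFieldTheory.Balaban1983to89.B7Prop8to10Local

/-!
# NODE N04 · [Balaban1985Averaging] — DISCHARGE DOSSIER at the NODE 00 worlds of record (Stage 2, carried to Stage 3 and to every
# record predicate refining Stage 2): the node BY NAME, its ten printed legs IN KERNEL FORM at the objects of record, the vacuity
# guard, non-vacuity, and the located readings «what this is ∕ is not» in kernel form

TRACK A (YM-PLAN §2b, node N04 of 28), seat `pub-ymgap-dag-n04-a` (prover, KNIT-BY-NAME; HUMAN RULING D-0062, chair R429, ROSTER-D0062 row n04).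
THEOREMS ONLY, def-free, sorry-free, standard axioms.  The CONVENTIONS OF RECORD block of the root module `Node00.Carriers` applies.  EVERYTHING
MATHEMATICAL BELOW IS AN EXISTING KERNEL THEOREM OF THE TREE, USED BY NAME (lit-balaban r04 ∕ b2b b07 lineages; node00-def's Stage-2∕3 chain); this
file is the referee-facing ASSEMBLY for R417 act (iv) (the referee reads the landed file against pp. 26–50 and the node's in-edge) — it re-proves nothing
of Bałaban's and moves no count by itself (species rule R414 (B)(v) + director-ym №5: the count moves on the chair's booking after the reads).

## THE NODE.  `Dag.B7_main ℓ := ℓ.b5 → ℓ.b7` (`…Balaban1983to89.Dag` :189) — «N04 · B7 cites B5 [2] (notation, averaging operations, propagators)»;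
ONE in-edge `b5 ↦ N02`.  Venue statement of record `YMDAG.N04 w P := Dag.B7_main (DagBinding.leavesP w P)` (`HOME/lean/ym-dag/N04_B7.lean`, re-pointed
4696d8010540c19b: `N04_holds (w) (hw : Node00.IsWorldOfRecord₂ w) (P) := Node00.b7_main_of_isWorldOfRecord₂ w hw P`) — DEFINITIONALLY the type proved here.
VACUITY GUARD (YM-PLAN §1 (i)): at every world of record the in-edge leaf `b5` HOLDS (N01 + N02 by name, §0) AND is NOT CONSUMED — the conclusion leaf `b7`
is proved outright (`N04_leaf_b7_at_record₂`); no ex-falso in either direction.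

## BOTH-LEGS TABLE (conjunct of `B7.Concl` ↔ typed decl (`B7.lean`) ↔ printed statement (CMP **98** (1985), journal page = PDF page + 16) ↔ carrier OF
## RECORD it is instantiated at (`Carriers2Frame.leaves_carriers₂_pinned`, `rfl`; `θ : Stage2Params`: dimension `d = θ.D`, block `L = θ.L`, coefficient
## C⋆-algebra `𝔸 = θ.𝔸`, gauge group `G = U(𝔸)`) ↔ the lineage theorem that proves it there, BY NAME ↔ constants) — kernel form: `N04_iff_legs₂`.
| # | typed conjunct | print | carrier of record | proved by (leg) | constants |
|---|---|---|---|---|---|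
| 1 | `B7.Prop1Printed L one` (:97) | Prop. 1 (51) p. 26 | `one = B7ConclOneStep.concreteOneStepBD 𝔸 L` — `U1 𝔸`-valued configurations on `ℤᵈ`, one-step average (42), index `(p′, c)` | `B7ConclOneStep.prop1Printed_BD` — `N04_leg_prop1` | `C₀ = 14464(d+1)²(d+4)²`, `c₂′ = 1/(512(d+1)(d+4)L²)` |
| 2 | `B7.Prop2Printed C₀ c₂′ kst` (:114) | Prop. 2 (52)–(54) p. 26 | `kst k = B7Prop2Explicit.concreteKStep d 𝔸 U(𝔸) L k` — `U(𝔸)`-valued configurations, k-fold average (43) | `B7Prop2Explicit.prop2Printed_concrete` at `avgClosed_unitaryUnits` — `N04_leg_prop2` | same `C₀`, `c₂′`; `c₂ = min{1/(3C₀), ½c₂′} = cB d L` |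
| 3 | `B7.Prop3Printed L c₂ one` (:302) | Prop. 3 (121)–(123) p. 36 | `one` as in row 1 (genuine Prop.-3 fields `Qcov`, `Ccov`) | `B7ConclOneStep.prop3Printed_BD` — `N04_leg_prop3` | `C₁ = 131072(d+1)²`, `c₃ ≤ c₂` |
| 4 | `B7.Prop4Printed kexp` (:353) | Prop. 4 (134)–(135) pp. 38–39 | `kexp = B7ConclKExp.concreteKExp 𝔸 U(𝔸) L` — k-fold expansion data (127), guard `grpDefect` | `B7ConclKExp.prop4Printed_K` — `N04_leg_prop4` | `C₂ = 16C₁`, `c₄ = cK d L` |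
| 5 | `B7.Prop5Printed kexp` (:482) | Prop. 5 (156)–(157) p. 42 | as row 4 | `B7ConclKExp.prop5Printed_K` — `N04_leg_prop5` | `C′₁ = 1600(d+1)(d+4)L^{d+1}`, `C₃ = C3Gen d L` |
| 6 | `B7.Prop6Printed kexp` (:518) | Prop. 6 (164) p. 43 | as row 4 | `B7ConclKExp.prop6Printed_K` — `N04_leg_prop6` | `O(1) = 200(d+1)` |
| 7 | `B7.Prop7Printed kexp` (:537) | Prop. 7 p. 43 | as row 4 | `B7ConclKExp.prop7Printed_K` — `N04_leg_prop7` | `C₂ = 16C₁′`, `C₁′ = 2097152(d+1)²` |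
| 8 | `B7.Prop8Printed gd` (:573) | Prop. 8 (173)–(175) p. 45 | `gd = B7ConclGauge.concreteGaugeData 𝔸 L` — index `(k, U₀)` with (52) at `α₀ = c₂`, classes (166)–(167), (176)–(177) | `B7ConclGauge.prop8Printed_G` — `N04_leg_prop8` | `C₃ = 1116`, `c₆ = 1/3000` |
| 9 | `B7.Prop9Printed L gone` (:628) | Prop. 9 (199)–(200) p. 49 | `gone = B7ConclGauge.concreteGaugeOneStep 𝔸 L` — the one-step data (180) of Sect. F | `B7ConclGauge.prop9Printed_G` — `N04_leg_prop9` | `C′₄ = 2400(d+1)(d+4)+1`, `C′₅ = 6d+1`, `c′₆ = c9 d L` |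
| 10 | `B7.Prop10Printed gd` (:650) | Prop. 10 (203)–(204) p. 50 | as row 8 | `B7ConclGauge.prop10Printed_G` — `N04_leg_prop10` | `C₄ = C4 d + 1`, `C′₅ = C5' d + 1`, `c₆ = c10 d L` |

## LOCATED READINGS (species words of the bg referee's 42-field cross-read `B7-CROSSREAD-N04.g47.md` 5161b6f8101863e4 — 42 CONFIRM ∕ 0 OVERTURN — and of
## `Node00.CarriersB7` ∕ `Node00.B7GaugeGroup`; cited, not re-litigated; §4 puts the gauge-group item in kernel form at WORLD level)
* (g1) the ONE ADMIT∕RESTRICT species item (R325 D2): the carriers are `ℤᵈ`-GLOBAL with global plaquette hypotheses ((44) «p ⊂ Ω′», (52) «on some set of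
  plaquettes», print p. 18 (4): Ω a union of k-blocks) — ADMIT-AS-TYPED for whole-lattice ∕ torus consumers, RESTRICT-noted for a region-local consumer
  (periodisation partly in tree: `…Spine.NE2.TorusBlockAveragePlaquette`, one step + Prop. 1, referee (r6)).
* (g2) GAUGE GROUP: the group of record reads `G = U(𝔸)` (ruling Q-N00-2; print p. 18 «a Lie subgroup G of a unitary group U(N)»).  §4: the node holds VERBATIM
  at every world bound over the SAME concrete carriers read at ANY subgroup `G ≤ 𝔸ˣ` closed under the average (42) at radius `¼` (`N04_at_run_of_avgClosed` ←
  `b7Concl_of_avgClosed`), in particular at `G = SU(N) ⊂ M_N(ℂ)`, operator norm (19), `1 ≤ N ≤ 12` — the physical `SU(2)`, `SU(3)` — with the PRINTED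
  N-independent constants (`N04_at_run_specialUnitary` ← `b7Concl_specialUnitary`); for `N ≥ 26` the radius-`¼` closure of `SU(N)` is REFUTED
  (`B7Prop2SpecialUnitary.not_avgClosed_specialUnitary`), so that assembly route does not serve those `N` (first missing lemma for `13 ≤ N`: the radius-`t`
  (`AvgClosedAt`) forms of Props. 4–7; Prop. 2 alone holds for every `N` with `c₂′(d, L, SU(N))`, `B7Prop2SpecialUnitary.prop2Printed_specialUnitaryGroup`).
* (g3) the 1985 CORNER-anchored block prescription (2); the transfer to [Balaban1987RG1] (0.3)–(0.4) centred blocks is row item «F6-TRANSFER», not folded here.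
* (r1) CONSUMER OBLIGATION: eight conclusion-side fields are real `⨆` without a `BddAbove` guard (`avgDevK`, `dQk`, `dCk`, `avgRatioDev`, `avgDev203∕204`,
  `avgCovDev`, `avgDev`); the lineage proves the TERMWISE bounds and passes to the sup by `Real.iSup_le` (B7ConclKExp :446 :457 :494, B7ConclGauge :236 :241
  :429 :434) — a consumer needing the bound at one bond imports those termwise kernels by name.  (r2) log branch: series (21) (`MatrixLog.mlog`) vs spectral
  (22)–(23) — they agree on `|X − 1| < 1`, i.e. in every regime the ten Props quantify over.  (r5) (124) is not a field of the carrier (`remC` = (122)'s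
  remainder by definition).  `L ≥ 2` any (print: L odd; [Balaban1987RG1] p. 253); `≤`∕`<` as typed in `B7.lean`.

## WHAT THIS IS ∕ IS NOT.  IS: the kernel reading of [Balaban1985Averaging] Props. 1–10 AS TYPED at the NODE 00 OBJECTS OF RECORD (Stage 2: `Node00.carriers₂ θ X`,
p394343 a0c530480bab; Stage 3: `carriers₃`, p404803), the node BY NAME at every such world and over EVERY record predicate refining Stage 2 on the world side
(the shape of dagwriter's `UVSplit.S_N04 Rec := AtRecord Rec Dag.B7_main`, cluster K3 «RenormalisationBeta»), with worlds of record EXHIBITED in the physical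
setting `d = 4`, `𝔸 = M_N(ℂ)` (§3) and every antecedent of every conjunct met (§3).  IS NOT: a statement about regions `Ω ⊊ ℤᵈ` or tori ((g1)), about the
1987 centred blocks ((g3)), about `SU(N)`, `N ≥ 13` ((g2)); nothing about nodes other than N04 (N01 ∕ N02 enter §0 only as the in-edge's inhabitation), the
construction `w.C` (Stage 5), the continuum limit, ℝ⁴, infinite volume, OS axioms, a mass gap or the Clay problem.  One finite four-torus programme at
fixed ε ([Balaban1989LargeFieldII] Thm 1 scope).

v2 (same seat, 2026-08-25 — §1–§4 byte-identical with v1 p408815 ca0acce1d8ca; §0's Stage-1 in-edge lemma `N04_antecedent_b5_at_record₁` WITHDRAWN as a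
restatement of the in-edge producer's own dossier theorem `Node00.N02Dossier.N02_leaf_b5_at_record` (landed meanwhile; gate dedup), which §0 now cites
BY NAME; imports `Node00.N02Dossier`, `B7ConclSubgroup` added): §5 records the DISCHARGE OF RECORD (chair R431
21:34:14Z, «A: 1∕28») and ref-A's located caveats (c1)–(c7) BY NAME with their kernel forms — (c1) Prop. 6 WITH ITS FIRST CLAUSE at the carrier of record
(`N04_leg_prop6_full` ← `B7Prop6FirstClause.prop6PrintedFull_K`), (c2) `N04_c2_gIdx_background`, (c6) `N04_c6_three_le_L` and the node at the `SU(N)`-read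
carriers for EVERY `N` (`N04_at_run_specialUnitary_all` ← `B7ConclSubgroup.concl_specialUnitary`), Stage-3 non-vacuity (`N04_worldOfRecord₃_exists` ← N02's
dossier witness) and the assembled `N04_discharge_of_record`.

v3 (seat generation g2, 2026-08-26 — §0–§5 byte-identical with v2 p409881 5a7adf104927; import `B7Prop3to7Local` added): §6 records the located item (g1)
«ℤᵈ-GLOBAL hypotheses ∕ RESTRICT» IN KERNEL FORM at the record's parameters — Props. 1–7 WITH THE PRINTED LOCALITY (`N04_leg_prop1_local` …
`N04_leg_prop7_local` ← b07's `B7Prop1Local.prop1∕2Printed_concrete_local`, g2's `B7Prop3to7Local.prop3Printed_localC`, `prop4…7Printed_K_local`): the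
small-field hypotheses (44)∕(52) (and `G`-valuedness) are assumed on `Δ(p′)` ∕ the four corner `k`-blocks ∕ `B(c₋) ∪ B(c₊)` ∕ `Bᵏ(c₋) ∪ Bᵏ(c₊)` ONLY —
a READING UPGRADE of the typed leaf (the «IS NOT … regions `Ω ⊊ ℤᵈ` ((g1))» above is thereby answered for Props. 1–7: hypothesis AND conclusion read on
the bonds of a finite box, so any region containing the box is covered); Props. 8–10 (gauge-transformation carriers) remain typed with the global hypothesis.
Count-neutral; the node statement of record is unchanged.

v4 (seat generation g2, 2026-08-26 — §0–§6 byte-identical with v3 p413088 5e69c62af363; import `B7Prop8to10Local` added): §7 completes the located item (g1)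
IN KERNEL FORM — Props. 8–10 WITH THE PRINTED LOCALITY at the record's parameters (`N04_leg_prop8_local`, `N04_leg_prop9_local`, `N04_leg_prop10_local` ←
g2's `B7Prop8to10Local.prop8∕9∕10Printed_G_local`) and the typed leaf at the five LOCAL carrier families with the record's constants (`N04_concl_local` ←
`B7Prop8to10Local.concl_local`).  Count-neutral; the node statement of record (global carriers) is unchanged.
-/

noncomputable section

namespace Literature.MathematicalPhysics.QuantumFieldTheory.Balaban1983to89.Node00

open scoped Matrix
open DagBinding DagDischargedII
open B7Prop2Explicit (C0 c2' concreteKStep unitaryUnits AvgClosed avgClosed_unitaryUnits prop2Printed_concrete)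
open B7Prop2SpecialUnitary (specialUnitaryUnits)
open B7ConclOneStep (Idx concreteOneStepBD prop1Printed_BD prop3Printed_BD)
open B7ConclKExp (KIdx concreteKExp prop4Printed_K prop5Printed_K prop6Printed_K prop7Printed_K)
open B7ConclGauge (GIdx cB cB_pos concreteGaugeData concreteGaugeOneStep prop8Printed_G prop9Printed_G prop10Printed_G)

/-! ## §0. The node is «b5 → b7»; the vacuity guard (in-edge inhabited, conclusion proved without it) -/

/-- **N04 reads «b5 → b7»** (`Iff.rfl`): the node is the implication from the in-edge leaf of N02 ([Balaban1984PropagatorsI] Props. 1.1–1.2) to its own leaf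
([Balaban1985Averaging] Props. 1–10). [cite: Balaban1985Averaging, Props. 1–10 pp.26–50 (the node's content; bookkeeping)] -/
theorem N04_iff_b5_imp_b7 (ℓ : Dag.Leaves) : Dag.B7_main ℓ ↔ (ℓ.b5 → ℓ.b7) := Iff.rfl

/-- The node from its OWN leaf alone — the in-edge is not needed (this is how every proof below concludes: no ex-falso route through `b5`).
[cite: Balaban1985Averaging, Props. 1–10 pp.26–50 (bookkeeping)] -/
theorem N04_of_leaf_b7 (ℓ : Dag.Leaves) (h : ℓ.b7) : Dag.B7_main ℓ := fun _ => h

/-- **VACUITY GUARD, in-edge side (Stage 2)**: at every Stage-2 world of record the in-edge leaf `b5` HOLDS — the producing node N02's dossier theorem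
`Node00.N02Dossier.N02_leaf_b5_at_record` (seat dag-n02-a: [Balaban1984PropagatorsI] Props. 1.1–1.2 ∧ (1.67) at the objects of record, with N01's `b4` consumed)
BY NAME, through `IsWorldOfRecord₂ → IsWorldOfRecord₁`. [cite: Balaban1984PropagatorsI, Props. 1.1–1.2 pp.33–36 (kernel version at the objects of record, via N02's dossier)] -/
theorem N04_antecedent_b5_at_record₂ (w : WorldP) (hw : IsWorldOfRecord₂ w) (P : B12.RunParams) : (leavesP w P).b5 :=
  N02_leaf_b5_at_record w (isWorldOfRecord₁_of_isWorldOfRecord₂ w hw) P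

/-- **VACUITY GUARD, conclusion side (Stage 2)**: at every Stage-2 world of record the node's OWN leaf `b7` holds OUTRIGHT (`carriers₂_b7`: `B7.Concl` at the
concrete carriers = `B7ConclConcrete.concl_concrete` by name) — the in-edge is not consumed. [cite: Balaban1985Averaging, Props. 1–10 pp.26–50 (kernel version of the lit-balaban lineage at the objects of record)] -/
theorem N04_leaf_b7_at_record₂ (w : WorldP) (hw : IsWorldOfRecord₂ w) (P : B12.RunParams) : (leavesP w P).b7 := by
  obtain ⟨θ, _, hup⟩ := hw
  obtain ⟨X, Y, Z, V, W, hP⟩ := hup P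
  show (w.up P).b7
  rw [hP]
  exact carriers₂_b7 θ X Y Z V W

/-! ## §1. THE NODE AT THE WORLDS OF RECORD, BY NAME (Stage 2, Stage 3, and every record predicate refining Stage 2) -/

/-- **N04 · [Balaban1985Averaging] AT EVERY NODE 00 WORLD OF RECORD (Stage 2), EVERY RUN** — `∀ w, IsWorldOfRecord₂ w → ∀ P, Dag.B7_main (leavesP w P)` (venue:
`YMDAG.N04 w P`), node00-def's `b7_main_of_isWorldOfRecord₂` BY NAME (p394343 a0c530480bab).  Hypotheses: the world-of-record predicate only (no named fact; the
in-edge is not consumed). [cite: Balaban1985Averaging, Props. 1–2 p.26, Prop. 3 p.36, Prop. 4 pp.38–39, Prop. 5 p.42, Props. 6–7 p.43, Prop. 8 p.45, Prop. 9 p.49, Prop. 10 p.50 — kernel versions of the lit-balaban lineages at the objects of record] -/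
theorem N04_at_record₂ : ∀ w : WorldP, IsWorldOfRecord₂ w → ∀ P : B12.RunParams, Dag.B7_main (leavesP w P) :=
  fun w hw P => b7_main_of_isWorldOfRecord₂ w hw P

/-- **N04 at every world of record, Stage 3** (the k-level [Balaban1984PropagatorsII] block pinned as well; `IsWorldOfRecord₃ → IsWorldOfRecord₂`, `Node00.Carriers3`
p404803) — the discharge is STABLE under the later pin. [cite: Balaban1985Averaging, Props. 1–10 pp.26–50 — kernel version at the objects of record, Stage 3] -/
theorem N04_at_record₃ : ∀ w : WorldP, IsWorldOfRecord₃ w → ∀ P : B12.RunParams, Dag.B7_main (leavesP w P) :=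
  fun w hw P => b7_main_of_isWorldOfRecord₃ w hw P

/-- **N04 over ANY world predicate refining Stage 2** (the later stages, the final record predicate on the world side): if `R w → IsWorldOfRecord₂ w` then the
node holds at every `R`-world, every run. [cite: Balaban1985Averaging, Props. 1–10 pp.26–50 — kernel version at the objects of record; bookkeeping] -/
theorem N04_of_refines₂ {R : WorldP → Prop} (hR : ∀ w : WorldP, R w → IsWorldOfRecord₂ w) :
    ∀ w : WorldP, R w → ∀ P : B12.RunParams, Dag.B7_main (leavesP w P) :=
  fun w hw P => b7_main_of_isWorldOfRecord₂ w (hR w hw) P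

/-- **N04 IN THE STUB SHAPE OF CLUSTER K3 «RenormalisationBeta»** (R422 typing policy: an explicit record-predicate PARAMETER over (family, datum, world) triples —
dagwriter's `UVSplit.S_N04 Rec := AtRecord Rec Dag.B7_main`, i.e. `∀ F D w, Rec F D w → ∀ P, Dag.B7_main (leavesP w P)`; the family and datum types are left
abstract here so that no continuum module is imported): for EVERY record predicate whose world component refines Stage 2, the stub holds — by
`b7_main_of_isWorldOfRecord₂`.  The day NODE 00's final `Rec` lands, `stub_N04` is this theorem applied to its Stage-2 projection.
[cite: Balaban1985Averaging, Props. 1–10 pp.26–50 — kernel version at the objects of record; bookkeeping over the record-predicate parameter] -/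
theorem N04_atRecord_of_refines₂ {Fam : Type*} {Dat : Fam → Type*} (Rec : ∀ F : Fam, Dat F → WorldP → Prop)
    (hst : ∀ (F : Fam) (D : Dat F) (w : WorldP), Rec F D w → IsWorldOfRecord₂ w) :
    ∀ (F : Fam) (D : Dat F) (w : WorldP), Rec F D w → ∀ P : B12.RunParams, Dag.B7_main (leavesP w P) :=
  fun F D w hR P => b7_main_of_isWorldOfRecord₂ w (hst F D w hR) P

/-- The same over record predicates refining Stage 3. [cite: Balaban1985Averaging, Props. 1–10 pp.26–50 — kernel version at the objects of record, Stage 3; bookkeeping] -/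
theorem N04_atRecord_of_refines₃ {Fam : Type*} {Dat : Fam → Type*} (Rec : ∀ F : Fam, Dat F → WorldP → Prop)
    (hst : ∀ (F : Fam) (D : Dat F) (w : WorldP), Rec F D w → IsWorldOfRecord₃ w) :
    ∀ (F : Fam) (D : Dat F) (w : WorldP), Rec F D w → ∀ P : B12.RunParams, Dag.B7_main (leavesP w P) :=
  fun F D w hR P => b7_main_of_isWorldOfRecord₃ w (hst F D w hR) P

/-! ## §2. BOTH LEGS IN KERNEL FORM: the ten printed propositions at the carriers of record, each the lineage's theorem BY NAME, and the node at a
## run of a Stage-2 ∕ Stage-3 world UNFOLDED to exactly their conjunction -/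

section Legs

variable (θ : Stage2Params)

/-- **Leg 1 — Proposition 1 (51) at the one-step family of record** (`U1 𝔸`-valued configurations on `ℤᵈ`, the average (42); `C₀ = 14464(d+1)²(d+4)²`,
`c₂′ = 1/(512(d+1)(d+4)L²)`): `B7ConclOneStep.prop1Printed_BD` by name. [cite: Balaban1985Averaging, Prop. 1 (51) p.26] -/
theorem N04_leg_prop1 : B7.Prop1Printed (θ.L : ℝ) (concreteOneStepBD θ.𝔸 (d := θ.D) θ.L) :=
  prop1Printed_BD θ.L (le_of_lt θ.hL.2)

/-- **Leg 2 — Proposition 2 (52)–(54) at the k-fold family of record** (`U(𝔸)`-valued configurations, the k-fold average (43), every `k`; the SAME `C₀`, `c₂′`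
and `c₂ = min{1/(3C₀), ½c₂′}` as printed): `B7Prop2Explicit.prop2Printed_concrete` at `avgClosed_unitaryUnits` by name. [cite: Balaban1985Averaging, Prop. 2 (52)–(54) p.26] -/
theorem N04_leg_prop2 : B7.Prop2Printed (C0 θ.D) (c2' θ.D θ.L) (fun k : ℕ => concreteKStep θ.D θ.𝔸 (unitaryUnits θ.𝔸) θ.L k) :=
  prop2Printed_concrete θ.L θ.toStage1Params.two_le_L (avgClosed_unitaryUnits θ.D θ.L)

/-- **Leg 3 — Proposition 3 (121)–(123) at the one-step family of record** (genuine fields `Q(V₀, A, c)`, `C(V₀, A, c)`; `C₁ = 131072(d+1)²`, `c₃ ≤ c₂ = cB d L`):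
`B7ConclOneStep.prop3Printed_BD` by name. [cite: Balaban1985Averaging, Prop. 3 (121)–(123) p.36] -/
theorem N04_leg_prop3 : B7.Prop3Printed (θ.L : ℝ) (cB θ.D θ.L) (concreteOneStepBD θ.𝔸 (d := θ.D) θ.L) :=
  prop3Printed_BD θ.L (le_of_lt θ.hL.2) (cB_pos θ.D (le_of_lt θ.hL.2))

/-- **Leg 4 — Proposition 4 (134)–(135) + analyticity at the k-fold expansion family of record** (`C₂ = 16C₁`, `c₄ = cK d L`, k-uniform):
`B7ConclKExp.prop4Printed_K` by name. [cite: Balaban1985Averaging, Prop. 4 (134)–(135) pp.38–39] -/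
theorem N04_leg_prop4 : B7.Prop4Printed (concreteKExp θ.𝔸 (unitaryUnits θ.𝔸) (d := θ.D) θ.L) :=
  prop4Printed_K θ.L θ.toStage1Params.two_le_L (avgClosed_unitaryUnits θ.D θ.L)

/-- **Leg 5 — Proposition 5 (156)–(157) at the k-fold expansion family of record** (`C′₁ = 1600(d+1)(d+4)L^{d+1}`, `C₃ = C3Gen d L`): `B7ConclKExp.prop5Printed_K`
by name. [cite: Balaban1985Averaging, Prop. 5 (156)–(157) p.42] -/
theorem N04_leg_prop5 : B7.Prop5Printed (concreteKExp θ.𝔸 (unitaryUnits θ.𝔸) (d := θ.D) θ.L) :=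
  prop5Printed_K θ.L θ.toStage1Params.two_le_L (avgClosed_unitaryUnits θ.D θ.L)

/-- **Leg 6 — Proposition 6 (164) at the k-fold expansion family of record** (`O(1) = 200(d+1)`): `B7ConclKExp.prop6Printed_K` by name.
[cite: Balaban1985Averaging, Prop. 6 (164) p.43] -/
theorem N04_leg_prop6 : B7.Prop6Printed (concreteKExp θ.𝔸 (unitaryUnits θ.𝔸) (d := θ.D) θ.L) :=
  prop6Printed_K θ.L θ.toStage1Params.two_le_L (avgClosed_unitaryUnits θ.D θ.L)

/-- **Leg 7 — Proposition 7 at the k-fold expansion family of record** (joint analyticity in `A′, A`; Prop. 4 uniformly in `A′`, `C₂ = 16C₁′`):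
`B7ConclKExp.prop7Printed_K` by name. [cite: Balaban1985Averaging, Prop. 7 p.43] -/
theorem N04_leg_prop7 : B7.Prop7Printed (concreteKExp θ.𝔸 (unitaryUnits θ.𝔸) (d := θ.D) θ.L) :=
  prop7Printed_K θ.L θ.toStage1Params.two_le_L (avgClosed_unitaryUnits θ.D θ.L)

/-- **Leg 8 — Proposition 8 (173)–(175) at the gauge-transformation family of record** (`C₃ = 1116`, `c₆ = 1/3000`): `B7ConclGauge.prop8Printed_G` by name.
[cite: Balaban1985Averaging, Prop. 8 (173)–(175) p.45] -/
theorem N04_leg_prop8 : B7.Prop8Printed (concreteGaugeData θ.𝔸 (d := θ.D) θ.L) :=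
  prop8Printed_G θ.L θ.toStage1Params.two_le_L

/-- **Leg 9 — Proposition 9 (199)–(200) at the one-step gauge family of record** (every ratio bound `M` for print's «α′₄ = O(α₄)»; `C′₄ = 2400(d+1)(d+4)+1`,
`C′₅ = 6d+1`, `c′₆ = c9 d L`): `B7ConclGauge.prop9Printed_G` by name. [cite: Balaban1985Averaging, Prop. 9 (199)–(200) p.49] -/
theorem N04_leg_prop9 : B7.Prop9Printed (θ.L : ℝ) (concreteGaugeOneStep θ.𝔸 (d := θ.D) θ.L) :=
  prop9Printed_G θ.L (le_of_lt θ.hL.2)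

/-- **Leg 10 — Proposition 10 (203)–(204) at the gauge-transformation family of record** (`C₄ = C4 d + 1`, `C′₅ = C5' d + 1`, `c₆ = c10 d L`):
`B7ConclGauge.prop10Printed_G` by name. [cite: Balaban1985Averaging, Prop. 10 (203)–(204) p.50] -/
theorem N04_leg_prop10 : B7.Prop10Printed (concreteGaugeData θ.𝔸 (d := θ.D) θ.L) :=
  prop10Printed_G θ.L θ.toStage1Params.two_le_L

variable (X : PrintedCarriersR) (Y : PrintedCarriers9X) (Z : PrintedCarriers11) (V : PrintedCarriers14R) (W : PrintedCarriers15)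
  (w : WorldP) (P : B12.RunParams)

/-- **The node at a Stage-2 run, UNFOLDED (no admissibility needed)**: if the run's upstream block is the N-binding over `carriers₂ θ X`, then `Dag.B7_main (leavesP w P)`
IS «`b5` of that binding → `B7.Concl` at the concrete carriers of record» — `Iff` by unfolding only (`leaves_carriers₂_pinned`).
[cite: Balaban1985Averaging, Props. 1–10 pp.26–50 (dictionary: what the node asserts at the objects of record)] -/
theorem N04_iff_b5_imp_concl₂ (hP : w.up P = Upstream.ofPrintedAllXPN (carriers₂ θ X) Y Z V W) :
    Dag.B7_main (leavesP w P) ↔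
      ((Upstream.ofPrintedAllXPN (carriers₂ θ X) Y Z V W).b5 →
        B7.Concl (θ.L : ℝ) (cB θ.D θ.L) (C0 θ.D) (c2' θ.D θ.L) (concreteOneStepBD θ.𝔸 (d := θ.D) θ.L)
          (fun k : ℕ => concreteKStep θ.D θ.𝔸 (unitaryUnits θ.𝔸) θ.L k) (concreteKExp θ.𝔸 (unitaryUnits θ.𝔸) (d := θ.D) θ.L)
          (concreteGaugeData θ.𝔸 (d := θ.D) θ.L) (concreteGaugeOneStep θ.𝔸 (d := θ.D) θ.L)) := by
  show ((w.up P).b5 → (w.up P).b7) ↔ _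
  rw [hP]
  exact Iff.rfl

/-- **THE BOTH-LEGS TABLE, KERNEL FORM.**  At a run `P` of a world whose upstream block is the N-binding over the Stage-2 bundle of record `carriers₂ θ X`
(admissible `θ`, so the in-edge `b5` holds and drops out), the node statement `Dag.B7_main (leavesP w P)` (venue `YMDAG.N04 w P`) IS — `Iff` — the conjunction
of the TEN PRINTED PROPOSITIONS AS TYPED at the carriers of record of the table: Prop. 1 ∧ Prop. 2 ∧ … ∧ Prop. 10.  Nothing hides behind the binding.
[cite: Balaban1985Averaging, Props. 1–2 p.26, Prop. 3 p.36, Prop. 4 pp.38–39, Prop. 5 p.42, Props. 6–7 p.43, Prop. 8 p.45, Prop. 9 p.49, Prop. 10 p.50 (dictionary: what the node asserts at the objects of record)] -/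
theorem N04_iff_legs₂ (hθ : θ.toStage1Params.Admissible) (hP : w.up P = Upstream.ofPrintedAllXPN (carriers₂ θ X) Y Z V W) :
    Dag.B7_main (leavesP w P) ↔
      B7.Prop1Printed (θ.L : ℝ) (concreteOneStepBD θ.𝔸 (d := θ.D) θ.L) ∧
      B7.Prop2Printed (C0 θ.D) (c2' θ.D θ.L) (fun k : ℕ => concreteKStep θ.D θ.𝔸 (unitaryUnits θ.𝔸) θ.L k) ∧
      B7.Prop3Printed (θ.L : ℝ) (cB θ.D θ.L) (concreteOneStepBD θ.𝔸 (d := θ.D) θ.L) ∧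
      B7.Prop4Printed (concreteKExp θ.𝔸 (unitaryUnits θ.𝔸) (d := θ.D) θ.L) ∧
      B7.Prop5Printed (concreteKExp θ.𝔸 (unitaryUnits θ.𝔸) (d := θ.D) θ.L) ∧
      B7.Prop6Printed (concreteKExp θ.𝔸 (unitaryUnits θ.𝔸) (d := θ.D) θ.L) ∧
      B7.Prop7Printed (concreteKExp θ.𝔸 (unitaryUnits θ.𝔸) (d := θ.D) θ.L) ∧
      B7.Prop8Printed (concreteGaugeData θ.𝔸 (d := θ.D) θ.L) ∧
      B7.Prop9Printed (θ.L : ℝ) (concreteGaugeOneStep θ.𝔸 (d := θ.D) θ.L) ∧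
      B7.Prop10Printed (concreteGaugeData θ.𝔸 (d := θ.D) θ.L) := by
  rw [N04_iff_b5_imp_concl₂ θ X Y Z V W w P hP]
  have hb5 : (Upstream.ofPrintedAllXPN (carriers₂ θ X) Y Z V W).b5 :=
    carriers₁_b5 θ.toStage1Params hθ (withB7OfRecord X θ.D θ.L θ.𝔸) Y Z V W
  exact ⟨fun h => let c := h hb5; ⟨c.p1, c.p2, c.p3, c.p4, c.p5, c.p6, c.p7, c.p8, c.p9, c.p10⟩,
    fun ⟨h1, h2, h3, h4, h5, h6, h7, h8, h9, h10⟩ _ => ⟨h1, h2, h3, h4, h5, h6, h7, h8, h9, h10⟩⟩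

/-- **The node at the run FROM THE TEN LEGS** (intro form; no admissibility needed): a proof of N04 at a Stage-2 run consumes exactly the ten printed propositions at
the carriers of record — no in-edge, no named fact, no placeholder. [cite: Balaban1985Averaging, Props. 1–10 pp.26–50 (assembly; bookkeeping)] -/
theorem N04_of_legs₂ (hP : w.up P = Upstream.ofPrintedAllXPN (carriers₂ θ X) Y Z V W)
    (h₁ : B7.Prop1Printed (θ.L : ℝ) (concreteOneStepBD θ.𝔸 (d := θ.D) θ.L))
    (h₂ : B7.Prop2Printed (C0 θ.D) (c2' θ.D θ.L) (fun k : ℕ => concreteKStep θ.D θ.𝔸 (unitaryUnits θ.𝔸) θ.L k))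
    (h₃ : B7.Prop3Printed (θ.L : ℝ) (cB θ.D θ.L) (concreteOneStepBD θ.𝔸 (d := θ.D) θ.L))
    (h₄ : B7.Prop4Printed (concreteKExp θ.𝔸 (unitaryUnits θ.𝔸) (d := θ.D) θ.L))
    (h₅ : B7.Prop5Printed (concreteKExp θ.𝔸 (unitaryUnits θ.𝔸) (d := θ.D) θ.L))
    (h₆ : B7.Prop6Printed (concreteKExp θ.𝔸 (unitaryUnits θ.𝔸) (d := θ.D) θ.L))
    (h₇ : B7.Prop7Printed (concreteKExp θ.𝔸 (unitaryUnits θ.𝔸) (d := θ.D) θ.L))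
    (h₈ : B7.Prop8Printed (concreteGaugeData θ.𝔸 (d := θ.D) θ.L))
    (h₉ : B7.Prop9Printed (θ.L : ℝ) (concreteGaugeOneStep θ.𝔸 (d := θ.D) θ.L))
    (h₁₀ : B7.Prop10Printed (concreteGaugeData θ.𝔸 (d := θ.D) θ.L)) : Dag.B7_main (leavesP w P) :=
  (N04_iff_b5_imp_concl₂ θ X Y Z V W w P hP).2 fun _ => ⟨h₁, h₂, h₃, h₄, h₅, h₆, h₇, h₈, h₉, h₁₀⟩

/-- **The node at the run, assembled LEG BY LEG from the ten lineage theorems** (a second proof of `b7_main_of_isWorldOfRecord₂`'s content at the run, routed through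
the table rather than through `B7ConclConcrete.concl_concrete`; needs only `L > 1`, no admissibility). [cite: Balaban1985Averaging, Props. 1–10 pp.26–50 — kernel versions of the lit-balaban lineages, assembled] -/
theorem N04_at_run₂ (hP : w.up P = Upstream.ofPrintedAllXPN (carriers₂ θ X) Y Z V W) : Dag.B7_main (leavesP w P) :=
  N04_of_legs₂ θ X Y Z V W w P hP (N04_leg_prop1 θ) (N04_leg_prop2 θ) (N04_leg_prop3 θ) (N04_leg_prop4 θ) (N04_leg_prop5 θ)
    (N04_leg_prop6 θ) (N04_leg_prop7 θ) (N04_leg_prop8 θ) (N04_leg_prop9 θ) (N04_leg_prop10 θ)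

/-- **The table at Stage 3**: over the Stage-3 bundle `carriers₃ θ₃ X = carriers₂ θ₃.toStage2Params (withB6KOfRecord X θ₃)` the node unfolds to the SAME «b5 → `B7.Concl`
at the concrete carriers» (the B6 pin does not touch the B7 group). [cite: Balaban1985Averaging, Props. 1–10 pp.26–50 (dictionary, Stage 3)] -/
theorem N04_iff_b5_imp_concl₃ (θ₃ : Stage3Params) (hP : w.up P = Upstream.ofPrintedAllXPN (carriers₃ θ₃ X) Y Z V W) :
    Dag.B7_main (leavesP w P) ↔
      ((Upstream.ofPrintedAllXPN (carriers₃ θ₃ X) Y Z V W).b5 →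
        B7.Concl (θ₃.L : ℝ) (cB θ₃.D θ₃.L) (C0 θ₃.D) (c2' θ₃.D θ₃.L) (concreteOneStepBD θ₃.𝔸 (d := θ₃.D) θ₃.L)
          (fun k : ℕ => concreteKStep θ₃.D θ₃.𝔸 (unitaryUnits θ₃.𝔸) θ₃.L k) (concreteKExp θ₃.𝔸 (unitaryUnits θ₃.𝔸) (d := θ₃.D) θ₃.L)
          (concreteGaugeData θ₃.𝔸 (d := θ₃.D) θ₃.L) (concreteGaugeOneStep θ₃.𝔸 (d := θ₃.D) θ₃.L)) :=
  N04_iff_b5_imp_concl₂ θ₃.toStage2Params (withB6KOfRecord X θ₃) Y Z V W w P hP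

end Legs

/-! ## §3. NON-VACUITY, BY NAME: Stage-2 worlds of record exist — also with `d = 4`, `𝔸 = M_N(ℂ)` — the index types are inhabited, the antecedents are met -/

/-- **There IS a Stage-2 world of record, and the node holds at it** (`Node00.Satisfiable.exists_isWorldOfRecord₂`) — the universally quantified discharge
`N04_at_record₂` is not about an empty class of worlds. [cite: Balaban1985Averaging, Props. 1–10 pp.26–50 (objects of record; bookkeeping)] -/
theorem N04_worldOfRecord₂_exists : ∃ w : WorldP, IsWorldOfRecord₂ w ∧ ∀ P : B12.RunParams, Dag.B7_main (leavesP w P) := by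
  obtain ⟨w, hw⟩ := exists_isWorldOfRecord₂
  exact ⟨w, hw, fun P => b7_main_of_isWorldOfRecord₂ w hw P⟩

section Matrices

open scoped Matrix.Norms.L2Operator

/-- **… in the physical setting**: for every `N ≥ 1` there is a Stage-2 world of record whose family parameters have lattice dimension `d = 4` and coefficient
C⋆-algebra `𝔸 = M_N(ℂ)` with the operator norm (19) — so the B7 group of record is the [Balaban1985Averaging] averages of `U(N)`-valued configurations on `ℤ⁴`
(print p. 18: «values in a Lie subgroup G of a unitary group U(N)») — with the node at every run.  Witness: the admissible `D = 4` parameters of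
`Stage1Params.exists_admissible`, any bundles (`Node00.Satisfiable`), a world re-bound to the constant N-binding (`isWorldOfRecord₂_of_up`).
[cite: Balaban1985Averaging, pp.18–21 (17)–(19), Props. 1–10 pp.26–50 (objects of record, d = 4, U(N) witness; bookkeeping)] -/
theorem N04_worldOfRecord₂_exists_dim4_matrix (N : ℕ) [NeZero N] :
    letI : CStarAlgebra (Matrix (Fin N) (Fin N) ℂ) := {}
    ∃ (θ₁ : Stage1Params) (w : WorldP), θ₁.Admissible ∧ θ₁.D = 4 ∧
      (∀ P : B12.RunParams, ∃ (X : PrintedCarriersR) (Y : PrintedCarriers9X) (Z : PrintedCarriers11) (V : PrintedCarriers14R)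
        (W : PrintedCarriers15),
          w.up P = Upstream.ofPrintedAllXPN (carriers₂ { toStage1Params := θ₁, 𝔸 := Matrix (Fin N) (Fin N) ℂ } X) Y Z V W) ∧
      IsWorldOfRecord₂ w ∧ ∀ P : B12.RunParams, Dag.B7_main (leavesP w P) := by
  letI : CStarAlgebra (Matrix (Fin N) (Fin N) ℂ) := {}
  obtain ⟨θ₁, hθ₁, hD⟩ := Stage1Params.exists_admissible
  obtain ⟨X⟩ := nonempty_printedCarriersR
  obtain ⟨Y⟩ := nonempty_printedCarriers9X
  obtain ⟨Z⟩ := nonempty_printedCarriers11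
  obtain ⟨V⟩ := nonempty_printedCarriers14R
  obtain ⟨W⟩ := nonempty_printedCarriers15
  obtain ⟨w₀⟩ := nonempty_worldP
  let θ₂ : Stage2Params := { toStage1Params := θ₁, 𝔸 := Matrix (Fin N) (Fin N) ℂ }
  have hw : IsWorldOfRecord₂ (WorldP.withUp w₀ fun _ => Upstream.ofPrintedAllXPN (carriers₂ θ₂ X) Y Z V W) :=
    isWorldOfRecord₂_of_up θ₂ hθ₁ X Y Z V W _ rfl
  exact ⟨θ₁, _, hθ₁, hD, fun P => ⟨X, Y, Z, V, W, rfl⟩, hw, fun P => b7_main_of_isWorldOfRecord₂ _ hw P⟩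

end Matrices

/-- **At every Stage-2 world of record and every run, the node holds ON NON-DEGENERATE CARRIERS**: the upstream block is the N-binding over some `carriers₂ θ X`
(admissible `θ`) ALL NINE of whose pinned index types are inhabited (`nonempty_indices₂_of_admissible`) and whose five [Balaban1985Averaging] families carry, at
every index and every positive threshold, data meeting EVERY antecedent of Props. 1–10 AS TYPED — (44)∕(52), (109), (166)–(167), (176)–(177), (180) —
(`b7_antecedents_met`, the unit configuration ∕ zero field ∕ identity transformation of `Node00.NonVacuityB7`); so none of the ten legs is an implication with
unsatisfiable hypotheses (vacuity standard Q-N00-6). [cite: Balaban1985Averaging, (44) p.24, (52) p.26, (109) p.34, (166)–(167) p.44, (176)–(177) p.45, (180) p.46, Props. 1–10 pp.26–50 («for α₀ … sufficiently small»; bookkeeping over the lineage's carriers)] -/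
theorem N04_at_record₂_nonvacuous (w : WorldP) (hw : IsWorldOfRecord₂ w) (P : B12.RunParams) :
    Dag.B7_main (leavesP w P) ∧
    ∃ (θ : Stage2Params) (X : PrintedCarriersR) (Y : PrintedCarriers9X) (Z : PrintedCarriers11) (V : PrintedCarriers14R) (W : PrintedCarriers15),
      θ.toStage1Params.Admissible ∧ w.up P = Upstream.ofPrintedAllXPN (carriers₂ θ X) Y Z V W ∧
      ((Nonempty (carriers₂ θ X).I4E ∧ Nonempty (carriers₂ θ X).I4U ∧ Nonempty (carriers₂ θ X).I4F ∧ Nonempty (carriers₂ θ X).I5) ∧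
        Nonempty (carriers₂ θ X).I7a ∧ Nonempty (carriers₂ θ X).I7b ∧ Nonempty (carriers₂ θ X).I7c ∧ Nonempty (carriers₂ θ X).I7d ∧
          Nonempty (carriers₂ θ X).I7e) ∧
      ∀ (i₁ : (carriers₂ θ X).I7a) (k : (carriers₂ θ X).I7b) (i₃ : (carriers₂ θ X).I7c) (α₀ α₁ α₃ α₄ : ℝ),
        0 < α₀ → 0 < α₁ → 0 < α₃ → 0 < α₄ →
        (∃ (V₁ : ((carriers₂ θ X).one7 i₁).Cfg) (A : ((carriers₂ θ X).one7 i₁).Fld),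
            ((carriers₂ θ X).one7 i₁).plaqDev V₁ < α₀ ∧ ((carriers₂ θ X).one7 i₁).fldNorm A < α₁) ∧
        (∃ U : ((carriers₂ θ X).kst7 k).Cfg, ((carriers₂ θ X).kst7 k).plaqDevEta U < α₀) ∧
        (∃ (U₀ : ((carriers₂ θ X).kexp7 i₃).Cfg) (A : ((carriers₂ θ X).kexp7 i₃).Fld),
            ((carriers₂ θ X).kexp7 i₃).plaqDevEta U₀ < α₀ ∧ ((carriers₂ θ X).kexp7 i₃).fldNorm A < α₁) ∧
        (∃ i : (carriers₂ θ X).I7d, ((carriers₂ θ X).gd7 i).k = k ∧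
            ∃ (U₀ : ((carriers₂ θ X).gd7 i).Cfg) (u : ((carriers₂ θ X).gd7 i).GT),
              ((carriers₂ θ X).gd7 i).plaqDevEta U₀ < α₀ ∧ ((carriers₂ θ X).gd7 i).InLambda U₀ α₃ u ∧ ((carriers₂ θ X).gd7 i).Reg176 α₄ u) ∧
        (∃ (V₀ : ((carriers₂ θ X).gone7 PUnit.unit).Cfg) (v' v₁ : ((carriers₂ θ X).gone7 PUnit.unit).GT),
            ((carriers₂ θ X).gone7 PUnit.unit).plaqDev V₀ < α₀ ∧ ((carriers₂ θ X).gone7 PUnit.unit).dev v' < α₄ ∧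
              ((carriers₂ θ X).gone7 PUnit.unit).covDev V₀ v' < α₄ ∧ ((carriers₂ θ X).gone7 PUnit.unit).dev v₁ < α₃ ∧
                ((carriers₂ θ X).gone7 PUnit.unit).blockCovDev V₀ v₁ < (carriers₂ θ X).L7 * α₃) := by
  refine ⟨b7_main_of_isWorldOfRecord₂ w hw P, ?_⟩
  obtain ⟨θ, hθ, hup⟩ := hw
  obtain ⟨X, Y, Z, V, W, hP⟩ := hup P
  exact ⟨θ, X, Y, Z, V, W, hθ, hP, nonempty_indices₂_of_admissible θ hθ X,
    fun i₁ k i₃ α₀ α₁ α₃ α₄ hα₀ hα₁ hα₃ hα₄ => b7_antecedents_met θ X i₁ k i₃ hα₀ hα₁ hα₃ hα₄⟩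

/-! ## §4. THE GAUGE-GROUP READING IN KERNEL FORM (located item (g2)): the node at worlds bound over the SAME concrete carriers read at any
## average-closed gauge group — in particular the paper's `SU(N) ⊂ M_N(ℂ)`, `N ≤ 12` — with the printed constants -/

/-- **The node at a run bound over ANY carrier bundle follows from `B7.Concl` of that bundle's B7 group** (the binding-agnostic content of N04: `b5` is not consumed).
[cite: Balaban1985Averaging, Props. 1–10 pp.26–50 (bookkeeping)] -/
theorem N04_at_run_of_concl (X : PrintedCarriersR) (Y : PrintedCarriers9X) (Z : PrintedCarriers11) (V : PrintedCarriers14R) (W : PrintedCarriers15)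
    (w : WorldP) (P : B12.RunParams) (hP : w.up P = Upstream.ofPrintedAllXPN X Y Z V W)
    (h : B7.Concl X.L7 X.c₂ X.C₀ X.c₂' X.one7 X.kst7 X.kexp7 X.gd7 X.gone7) : Dag.B7_main (leavesP w P) := by
  intro _
  show (w.up P).b7
  rw [hP]
  exact h

/-- **N04 at every world bound over the concrete carriers READ AT ANY AVERAGE-CLOSED GAUGE GROUP `G ≤ 𝔸ˣ`** (`B7Prop2Explicit.AvgClosed d L G`: closure under the
one-step average (42) at radius `¼`): the carrier bundle is `withB7OfRecord X d L 𝔸` with the k-fold averages (43) and the k-fold expansion data read at `G` instead of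
`U(𝔸)` (written out field by field; no new definition), every `d`, every `L ≥ 2`, every non-trivial C⋆-algebra `𝔸`; the leaf is node00-def's `b7Concl_of_avgClosed` by
name, with the printed constants. [cite: Balaban1985Averaging, Props. 1–10 pp.26–50, p.18 («a Lie subgroup G of a unitary group U(N)»), (42)–(43) pp.23–24 — kernel versions of the lineages, assembled at G] -/
theorem N04_at_run_of_avgClosed (d L : ℕ) (hL : 2 ≤ L) (𝔸 : Type) [CStarAlgebra 𝔸] [Nontrivial 𝔸] {G : Subgroup 𝔸ˣ} (hG : AvgClosed d L G)
    (X : PrintedCarriersR) (Y : PrintedCarriers9X) (Z : PrintedCarriers11) (V : PrintedCarriers14R) (W : PrintedCarriers15) (w : WorldP)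
    (P : B12.RunParams) (hP : w.up P = Upstream.ofPrintedAllXPN
      { X with
        I7a := Idx d, I7b := ℕ, I7c := KIdx d, I7d := GIdx 𝔸 d L, I7e := PUnit, L7 := (L : ℝ), c₂ := cB d L, C₀ := C0 d, c₂' := c2' d L,
        one7 := concreteOneStepBD 𝔸 (d := d) L, kst7 := fun k : ℕ => concreteKStep d 𝔸 G L k, kexp7 := concreteKExp 𝔸 G (d := d) L,
        gd7 := concreteGaugeData 𝔸 (d := d) L, gone7 := concreteGaugeOneStep 𝔸 (d := d) L } Y Z V W) :
    Dag.B7_main (leavesP w P) :=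
  N04_at_run_of_concl _ Y Z V W w P hP (b7Concl_of_avgClosed d L hL 𝔸 hG)

section SpecialUnitary

open scoped Matrix.Norms.L2Operator

/-- **N04 at every world bound over the concrete carriers read at the paper's `G = SU(N) ⊂ M_N(ℂ)`** (operator norm (19)), `1 ≤ N ≤ 12` — so the physical
`SU(2)`, `SU(3)` —, every `d`, every `L ≥ 2`, WITH THE PRINTED `N`-INDEPENDENT CONSTANTS `c₂ = min{1/(3C₀), ½c₂′}`, `C₀ = 14464(d+1)²(d+4)²`,
`c₂′ = 1/(512(d+1)(d+4)L²)`: `SU(N)` is closed under (42) at radius `¼` when `N/4 < π` (node00-def's `avgClosed_specialUnitary` ← b07's `avgClosedAt_specialUnitary`),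
and the leaf is `b7Concl_specialUnitary` by name.  (For `N ≥ 26` that closure is refuted, `B7Prop2SpecialUnitary.not_avgClosed_specialUnitary`; nothing is claimed
here for `N ≥ 13`.) [cite: Balaban1985Averaging, Props. 1–10 pp.26–50, setting pp.18–21 (17)–(19) (kernel version; SU(N), N ≤ 12, at world level)] -/
theorem N04_at_run_specialUnitary (N : ℕ) [NeZero N] (hN : N ≤ 12) (d L : ℕ) (hL : 2 ≤ L) (X : PrintedCarriersR) (Y : PrintedCarriers9X)
    (Z : PrintedCarriers11) (V : PrintedCarriers14R) (W : PrintedCarriers15) (w : WorldP) (P : B12.RunParams) :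
    letI : CStarAlgebra (Matrix (Fin N) (Fin N) ℂ) := {}
    w.up P = Upstream.ofPrintedAllXPN
      { X with
        I7a := Idx d, I7b := ℕ, I7c := KIdx d, I7d := GIdx (Matrix (Fin N) (Fin N) ℂ) d L, I7e := PUnit, L7 := (L : ℝ), c₂ := cB d L,
        C₀ := C0 d, c₂' := c2' d L,
        one7 := concreteOneStepBD (Matrix (Fin N) (Fin N) ℂ) (d := d) L,
        kst7 := fun k : ℕ => concreteKStep d (Matrix (Fin N) (Fin N) ℂ) (specialUnitaryUnits (Fin N)) L k,
        kexp7 := concreteKExp (Matrix (Fin N) (Fin N) ℂ) (specialUnitaryUnits (Fin N)) (d := d) L,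
        gd7 := concreteGaugeData (Matrix (Fin N) (Fin N) ℂ) (d := d) L,
        gone7 := concreteGaugeOneStep (Matrix (Fin N) (Fin N) ℂ) (d := d) L } Y Z V W →
    Dag.B7_main (leavesP w P) := by
  letI : CStarAlgebra (Matrix (Fin N) (Fin N) ℂ) := {}
  intro hP
  exact N04_at_run_of_avgClosed d L hL (Matrix (Fin N) (Fin N) ℂ) (avgClosed_specialUnitary hN d L) X Y Z V W w P hP

end SpecialUnitary

/-! ## §5. THE DISCHARGE OF RECORD (chair R431, 2026-08-25T21:34:14Z: «N04 [B7] DISCHARGED OF RECORD — THE FIRST NODE», 1∕28) AND THE REFEREE'S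
## LOCATED CAVEATS (c1)–(c7) BY NAME (ref-A ★ DISCHARGE READ #1, INBOX l.8915, verdict PASS; R431's condition subsequent «N04Dossier cites (c1)–(c7)»)

Every caveat is in the direction typed WEAKER-than-or-equal-to print (ref-A: «none hides an un-printed estimate ⇒ SECOND-GAP none»); the species words
are the chair's (R431).  Kernel content is added only where the tree has a theorem to point at; the rest is cited by name.
* (c1) **Prop. 6 FIRST CLAUSE** («`(U′U₀)‾ᵏ` is an analytic function of `A′`», p. 43) is NOT a field of `B7.KExp` ∕ `B7.Prop6Printed` (:518 types only (164));
  r04's superseding decl `B7Prop6FirstClause.Prop6PrintedFull` over `KExpA` IS inhabited at the SAME concrete carrier: `N04_leg_prop6_full` below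
  (`prop6PrintedFull_K` by name at `θ`), its (164) member being leg 6 verbatim (`N04_leg_prop6_of_full`).  Species ADMIT-AS-TYPED + CONSUMER RULE (R431):
  a downstream user of Prop. 6's analyticity ([B9] p. 406) imports `B7Prop6FirstClause.prop6AnalyticPrinted_K` ∕ `prop6PrintedFull_K` (or `N04_leg_prop6_full`)
  BY NAME — it is not readable off the leaf `b7`.
* (c2) Prop. 8 is typed on the index `GIdx` whose backgrounds carry (52) at `α₀ = c₂ = cB d L` (print's Prop. 8 states no (52): D-b07.3) and its «and (173)»
  clause is not a field (`B7ConclGauge` :54 «NOT CLAIMED») — species RESTRICT (R431); kernel: `N04_c2_gIdx_background` (every index background satisfies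
  (52) at `c₂`); harmless for Prop. 10 (`c10 ≤ cB`, `B7ConclGauge.c10_le`).
* (c3) Prop. 3's (124) and Prop. 4's (136) are display-definitions, not typed ((r5)); Prop. 10's (204) is typed in the closed form `α₄(1 + 4C′₅Lʲη)`, WEAKER
  than print's sum (`B7.ineq204_closed`: printed sum `≤` closed form, D-b07.2) — ADMIT-AS-TYPED.
* (c4) `Q_k` is typed as the composite (127) `logCovIter`, identified with a logarithm of the genuine k-fold average by `B7Prop6GeneralAnalytic.avgIter_eq_avgQG`
  (k-fold average of `e^{B}U₀` = `w_k·e^{Q_k}·Ū₀ᵏ·w_k⁻¹` under the Prop.-4 smallness); which branch of the logarithm is the (r2) convention — ADMIT-AS-TYPED.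
* (c5) the analyticity clauses are typed on EVERY finite bond family `S` (zero off `S`, `insCfg`), containing print's variable set `Bᵏ(c₋) ∪ Bᵏ(c₊)` as a slice;
  print's «function of [only] those variables» locality is NOT asserted — same species as (g1) — ADMIT-AS-TYPED.
* (c6) RESTRICT OF WORLDS, not of [B7]: the group of record is `G = U(𝔸)` (booked #110; §4 above gives the node at the `SU(N)`-read carriers for `N ≤ 12`
  via `AvgClosed`, and `N04_at_run_specialUnitary_all` below for EVERY `N ≥ 1` via the antitone transfer of `B7ConclSubgroup` — the typed propositions read
  `G` on the hypothesis side only; the tacit printed `G`-valuedness of the averages stays `N`-dependent, `B7ConclSubgroup.concl_specialUnitary_and_caveat`);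
  and `L` is odd `≥ 3` at the record (`N04_c6_three_le_L`) while the [B7] legs hold for every `L ≥ 2` (`N04_at_run₂` consumes only `1 < L`).
* (c7) plumbing: the `grpDefect` guard makes `plaqDevEta U < α₀ ⟹ «U is G-valued ∧ (52)»` for `α₀ ≤ 1` (`B7ConclKExp.regime_of_dev_lt`, (r3)).
-/

section RecordCaveats

variable (θ : Stage2Params)

/-- **(c1) in kernel form — Proposition 6 WITH ITS FIRST CLAUSE at the k-fold expansion family of record** (r04's `B7Prop6FirstClause.concreteKExpA θ.𝔸 U(𝔸) θ.L`
= leg 6's carrier `concreteKExp` extended by the predicate «`(U′U₀)‾ᵏ(c)` is analytic in every finite family of the variables `A′_b` on the polydisc of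
radius `α₁`», the average being the GENUINE k-fold `avgIter` (43)); both clauses under the one threshold `cK d L`, `O(1) = 200(d+1)`:
`B7Prop6FirstClause.prop6PrintedFull_K` by name.  This is the theorem a consumer of Prop. 6's analyticity at the worlds of record imports (R431 consumer rule).
[cite: Balaban1985Averaging, Prop. 6 p.43 (first clause «analytic function of A′») and (164) p.43] -/
theorem N04_leg_prop6_full :
    B7Prop6FirstClause.Prop6PrintedFull (B7Prop6FirstClause.concreteKExpA θ.𝔸 (unitaryUnits θ.𝔸) (d := θ.D) θ.L) :=
  B7Prop6FirstClause.prop6PrintedFull_K θ.L θ.toStage1Params.two_le_L (avgClosed_unitaryUnits θ.D θ.L)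

/-- **(c1), consistency**: the (164) member of the full Prop. 6 at the record's carrier IS leg 6's typed statement `B7.Prop6Printed (concreteKExp …)` (the
extended carrier forgets to leg 6's, `concreteKExpA_toKExp`, `rfl`). [cite: Balaban1985Averaging, Prop. 6 (164) p.43 (bookkeeping)] -/
theorem N04_leg_prop6_of_full : B7.Prop6Printed (concreteKExp θ.𝔸 (unitaryUnits θ.𝔸) (d := θ.D) θ.L) :=
  (N04_leg_prop6_full θ).toProp6Printed

/-- **(c2) in kernel form**: every index of the gauge-transformation family of record carries a `U(𝔸)`-valued background satisfying (52) at `α₀ = c₂ = cB d L`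
(the RESTRICT under which Prop. 8 is typed; print's Prop. 8 states no (52), D-b07.3). [cite: Balaban1985Averaging, (52) p.26, Prop. 8 p.45 (the typed family's index condition; bookkeeping)] -/
theorem N04_c2_gIdx_background (i : GIdx θ.𝔸 θ.D θ.L) :
    (∀ (x : B7Prop1Explicit.Site θ.D) (κ : Fin θ.D), i.U₀ x κ ∈ unitaryUnits θ.𝔸) ∧
      B7Prop2Explicit.pdev i.U₀ * ((θ.L : ℝ) ^ i.k) ^ 2 < cB θ.D θ.L :=
  ⟨i.hU₀, i.h52⟩

/-- **(c6) in kernel form, block size**: at the record `L` is odd and `> 1`, hence `3 ≤ L` (`Stage1Params.hL`), while every [B7] leg above consumes only `2 ≤ L`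
(`N04_at_run₂`: `1 < L`) — a RESTRICT of worlds, not of [B7]. [cite: Balaban1987RG1, p.253 («L an odd positive integer»; bookkeeping); Balaban1985Averaging, Props. 1–10 pp.26–50 (L ≥ 2 in the lineage)] -/
theorem N04_c6_three_le_L (θ₁ : Stage1Params) : 3 ≤ θ₁.L := by
  obtain ⟨⟨m, hm⟩, h1⟩ := θ₁.hL
  omega

end RecordCaveats

section SpecialUnitaryAll

open scoped Matrix.Norms.L2Operator
open B7ConclSubgroup (concl_specialUnitary)

/-- **(c6) in kernel form, gauge group — N04 at every world bound over the concrete carriers read at the paper's `G = SU(N) ⊂ M_N(ℂ)` (operator norm (19)),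
EVERY `N ≥ 1`**, every `d`, every `L ≥ 2`, with the PRINTED `N`-independent constants: the statement of `N04_at_run_specialUnitary` WITHOUT `N ≤ 12`, through
`B7ConclSubgroup.concl_specialUnitary` (the typed Props. 1–10 read the gauge group on the hypothesis side only, so they transfer from `U(N)` to `SU(N) ≤ U(N)`).
NOT CLAIMED: that the averages of `SU(N)`-valued small fields are `SU(N)`-valued — false below any `N`-independent threshold
(`B7ConclSubgroup.concl_specialUnitary_and_caveat` ← b07's `avg_not_specialUnitary_valued`), and no conjunct of the typed leaf.
[cite: Balaban1985Averaging, Props. 1–10 pp.26–50, setting pp.18–21 (17)–(19) (kernel version; SU(N), every N, at world level)] -/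
theorem N04_at_run_specialUnitary_all (N : ℕ) [NeZero N] (d L : ℕ) (hL : 2 ≤ L) (X : PrintedCarriersR) (Y : PrintedCarriers9X)
    (Z : PrintedCarriers11) (V : PrintedCarriers14R) (W : PrintedCarriers15) (w : WorldP) (P : B12.RunParams) :
    letI : CStarAlgebra (Matrix (Fin N) (Fin N) ℂ) := {}
    w.up P = Upstream.ofPrintedAllXPN
      { X with
        I7a := Idx d, I7b := ℕ, I7c := KIdx d, I7d := GIdx (Matrix (Fin N) (Fin N) ℂ) d L, I7e := PUnit, L7 := (L : ℝ), c₂ := cB d L,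
        C₀ := C0 d, c₂' := c2' d L,
        one7 := concreteOneStepBD (Matrix (Fin N) (Fin N) ℂ) (d := d) L,
        kst7 := fun k : ℕ => concreteKStep d (Matrix (Fin N) (Fin N) ℂ) (specialUnitaryUnits (Fin N)) L k,
        kexp7 := concreteKExp (Matrix (Fin N) (Fin N) ℂ) (specialUnitaryUnits (Fin N)) (d := d) L,
        gd7 := concreteGaugeData (Matrix (Fin N) (Fin N) ℂ) (d := d) L,
        gone7 := concreteGaugeOneStep (Matrix (Fin N) (Fin N) ℂ) (d := d) L } Y Z V W →
    Dag.B7_main (leavesP w P) := by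
  letI : CStarAlgebra (Matrix (Fin N) (Fin N) ℂ) := {}
  intro hP
  exact N04_at_run_of_concl _ Y Z V W w P hP (concl_specialUnitary N d L hL)

end SpecialUnitaryAll

/-- **Non-vacuity at Stage 3**: a Stage-3 world of record EXISTS (N02's dossier witness `N02_worldOfRecord₃_exists`, by name) and the node holds at it —
`N04_at_record₃` is not about an empty class either. [cite: Balaban1985Averaging, Props. 1–10 pp.26–50; Balaban1984PropagatorsII, pp.223–250 (objects of record, Stage 3; bookkeeping)] -/
theorem N04_worldOfRecord₃_exists : ∃ w : WorldP, IsWorldOfRecord₃ w ∧ ∀ P : B12.RunParams, Dag.B7_main (leavesP w P) := by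
  obtain ⟨w, hw, _⟩ := N02_worldOfRecord₃_exists
  exact ⟨w, hw, fun P => b7_main_of_isWorldOfRecord₃ w hw P⟩

/-- **THE DISCHARGE OF RECORD, ASSEMBLED** (chair R431: acts (i)–(v) complete; «A: 1∕28»): at every Stage-2 world of record and every run — the node `Dag.B7_main`
(act (i): `Node00.b7_main_of_isWorldOfRecord₂` by name), its in-edge leaf `b5` INHABITED and its own leaf `b7` proved OUTRIGHT (vacuity guard, ref-A A5), and
Prop. 6 WITH ITS FIRST CLAUSE at the same world's k-fold carrier of record (caveat (c1), kernel-closed).  Nothing of the species words is asserted here; they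
are the chair's (R431) on ref-A's read (INBOX l.8915) and GEN 47 ∕ GEN 64's concurrence. [cite: Balaban1985Averaging, Props. 1–10 pp.26–50, Prop. 6 p.43 first clause (kernel versions at the objects of record; bookkeeping of the booked discharge)] -/
theorem N04_discharge_of_record (w : WorldP) (hw : IsWorldOfRecord₂ w) (P : B12.RunParams) :
    Dag.B7_main (leavesP w P) ∧ (leavesP w P).b5 ∧ (leavesP w P).b7 ∧
      ∃ (θ : Stage2Params) (X : PrintedCarriersR) (Y : PrintedCarriers9X) (Z : PrintedCarriers11) (V : PrintedCarriers14R) (W : PrintedCarriers15),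
        θ.toStage1Params.Admissible ∧ w.up P = Upstream.ofPrintedAllXPN (carriers₂ θ X) Y Z V W ∧
          B7Prop6FirstClause.Prop6PrintedFull (B7Prop6FirstClause.concreteKExpA θ.𝔸 (unitaryUnits θ.𝔸) (d := θ.D) θ.L) := by
  refine ⟨N04_at_record₂ w hw P, N04_antecedent_b5_at_record₂ w hw P, N04_leaf_b7_at_record₂ w hw P, ?_⟩
  obtain ⟨θ, hθ, hup⟩ := hw
  obtain ⟨X, Y, Z, V, W, hP⟩ := hup P
  exact ⟨θ, X, Y, Z, V, W, hθ, hP, N04_leg_prop6_full θ⟩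

/-! ## §6. THE LOCATED ITEM (g1) «ℤᵈ-GLOBAL HYPOTHESES ∕ RESTRICT» IN KERNEL FORM (v3, seat g2): Propositions 1–7 WITH THE PRINTED LOCALITY at
## the record's parameters `(d, L, 𝔸, G) = (θ.D, θ.L, θ.𝔸, U(θ.𝔸))` — b07's `B7Prop1Local` (Props. 1–2) and `B7Prop3to7Local` (Props. 3–7) BY NAME;
## a READING UPGRADE of the typed leaf (hypotheses on `Δ(p′)` ∕ `B(c₋) ∪ B(c₊)` ∕ the corner blocks ∕ `Bᵏ(c₋) ∪ Bᵏ(c₊)` only), count-neutral;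
## Props. 8–10 (gauge-transformation carriers) remain typed with the global hypothesis -/

section LocalLegs

open B7Prop1Local (concreteOneStepLocal concreteKStepLocal prop1Printed_concrete_local prop2Printed_concrete_local)
open B7Prop3to7Local (concreteOneStepLocalC concreteKExpLocal prop3Printed_localC prop4Printed_K_local prop5Printed_K_local
  prop6Printed_K_local prop7Printed_K_local)

variable (θ : Stage2Params)

/-- **Leg 1, printed locality — Proposition 1 (51) with «(44) for `p ⊂ Δ(p′)`»** at the record's `(d, L, 𝔸)`: b07's `B7Prop1Local.prop1Printed_concrete_local`
by name (same `C₀`, `c₂′`). [cite: Balaban1985Averaging, Prop. 1 (51) p.26, (46) p.25] -/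
theorem N04_leg_prop1_local : B7.Prop1Printed (θ.L : ℝ) (concreteOneStepLocal θ.𝔸 (d := θ.D) θ.L) :=
  prop1Printed_concrete_local θ.L (le_of_lt θ.hL.2)

/-- **Leg 2, printed locality — Proposition 2 (54) with (52) on the four corner `k`-blocks of `p` only** at the record's `(d, L, 𝔸, U(𝔸))`:
b07's `B7Prop1Local.prop2Printed_concrete_local` by name (same `C₀`, `c₂′`, `c₂`). [cite: Balaban1985Averaging, Prop. 2 (52)–(54) p.26 + the sentence after (54)] -/
theorem N04_leg_prop2_local : B7.Prop2Printed (C0 θ.D) (c2' θ.D θ.L) (concreteKStepLocal θ.D θ.𝔸 (unitaryUnits θ.𝔸) θ.L) :=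
  prop2Printed_concrete_local θ.L θ.toStage1Params.two_le_L (avgClosed_unitaryUnits θ.D θ.L)

/-- **Leg 3, printed locality — Proposition 3 (121)–(123) with (44) on `B(c₋) ∪ B(c₊)` only** at the record's `(d, L, 𝔸)` (`c₃ ≤ c₂ = cB d L`):
`B7Prop3to7Local.prop3Printed_localC` by name (same `C₁`, `c₃` as leg 3). [cite: Balaban1985Averaging, Prop. 3 (121)–(123) p.36, p.34 (locality sentence)] -/
theorem N04_leg_prop3_local : B7.Prop3Printed (θ.L : ℝ) (cB θ.D θ.L) (concreteOneStepLocalC θ.𝔸 (d := θ.D) θ.L) :=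
  prop3Printed_localC θ.L (le_of_lt θ.hL.2) (cB_pos θ.D (le_of_lt θ.hL.2))

/-- **Leg 4, printed locality — Proposition 4 (134)–(135) + analyticity with (52) on `Bᵏ(c₋) ∪ Bᵏ(c₊)` only** at the record's `(d, L, 𝔸, U(𝔸))`:
`B7Prop3to7Local.prop4Printed_K_local` by name. [cite: Balaban1985Averaging, Prop. 4 (134)–(135) pp.38–39, p.24 (sentence after (43))] -/
theorem N04_leg_prop4_local : B7.Prop4Printed (concreteKExpLocal θ.𝔸 (unitaryUnits θ.𝔸) (d := θ.D) θ.L) :=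
  prop4Printed_K_local θ.L θ.toStage1Params.two_le_L (avgClosed_unitaryUnits θ.D θ.L)

/-- **Leg 5, printed locality — Proposition 5 (156)–(157) with (52) on `Bᵏ(c₋) ∪ Bᵏ(c₊)` only**: `B7Prop3to7Local.prop5Printed_K_local` by name.
[cite: Balaban1985Averaging, Prop. 5 (156)–(157) p.42, p.24 (sentence after (43))] -/
theorem N04_leg_prop5_local : B7.Prop5Printed (concreteKExpLocal θ.𝔸 (unitaryUnits θ.𝔸) (d := θ.D) θ.L) :=
  prop5Printed_K_local θ.L θ.toStage1Params.two_le_L (avgClosed_unitaryUnits θ.D θ.L)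

/-- **Leg 6, printed locality — Proposition 6 (164), read at the bond `c`, with (52) on `Bᵏ(c₋) ∪ Bᵏ(c₊)` only**: `B7Prop3to7Local.prop6Printed_K_local` by name.
[cite: Balaban1985Averaging, Prop. 6 (164) p.43, p.24 (sentence after (43))] -/
theorem N04_leg_prop6_local : B7.Prop6Printed (concreteKExpLocal θ.𝔸 (unitaryUnits θ.𝔸) (d := θ.D) θ.L) :=
  prop6Printed_K_local θ.L θ.toStage1Params.two_le_L (avgClosed_unitaryUnits θ.D θ.L)

/-- **Leg 7, printed locality — Proposition 7 with (52) on `Bᵏ(c₋) ∪ Bᵏ(c₊)` only**: `B7Prop3to7Local.prop7Printed_K_local` by name.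
[cite: Balaban1985Averaging, Prop. 7 p.43, p.24 (sentence after (43))] -/
theorem N04_leg_prop7_local : B7.Prop7Printed (concreteKExpLocal θ.𝔸 (unitaryUnits θ.𝔸) (d := θ.D) θ.L) :=
  prop7Printed_K_local θ.L θ.toStage1Params.two_le_L (avgClosed_unitaryUnits θ.D θ.L)

end LocalLegs

/-! ## §7. THE LOCATED ITEM (g1) COMPLETED (v4, seat g2): Propositions 8–10 WITH THE PRINTED LOCALITY and the leaf `B7.Concl` at the five LOCAL carrier
## families, at the record's parameters — `B7Prop8to10Local` BY NAME; count-neutral; the node statement of record is unchanged -/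

section LocalLegsGauge

open B7Prop1Local (concreteKStepLocal)
open B7Prop3to7Local (concreteKExpLocal)
open B7Prop8to10Local (concreteGaugeOneStepLocal concreteGaugeDataLocal concreteOneStepLocalUnion prop8Printed_G_local prop9Printed_G_local
  prop10Printed_G_local concl_local)

variable (θ : Stage2Params)

/-- **Leg 8, printed locality — Proposition 8 with (166)–(167) on `Bᵏ(c₋) ∪ Bᵏ(c₊)` only** at the record's `(d, L, 𝔸)`: `B7Prop8to10Local.prop8Printed_G_local` by name.
[cite: Balaban1985Averaging, Prop. 8 p.45, (166)–(167) p.44, p.24 (locality)] -/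
theorem N04_leg_prop8_local : B7.Prop8Printed (concreteGaugeDataLocal θ.𝔸 (d := θ.D) θ.L) :=
  prop8Printed_G_local θ.L θ.toStage1Params.two_le_L

/-- **Leg 9, printed locality — Proposition 9 (199)–(200) with (180) on `B(c₋) ∪ B(c₊)` only**: `B7Prop8to10Local.prop9Printed_G_local` by name.
[cite: Balaban1985Averaging, Prop. 9 (199)–(200) p.49, (180) p.46, p.24 (locality)] -/
theorem N04_leg_prop9_local : B7.Prop9Printed (θ.L : ℝ) (concreteGaugeOneStepLocal θ.𝔸 (d := θ.D) θ.L) :=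
  prop9Printed_G_local θ.L (le_of_lt θ.hL.2)

/-- **Leg 10, printed locality — Proposition 10 (203)–(204) with (52)/(176)/(177)/(166)/(167) on `Bᵏ(c₋) ∪ Bᵏ(c₊)` only**: `B7Prop8to10Local.prop10Printed_G_local`
by name. [cite: Balaban1985Averaging, Prop. 10 p.50, (203)–(204) p.49, p.24 (locality)] -/
theorem N04_leg_prop10_local : B7.Prop10Printed (concreteGaugeDataLocal θ.𝔸 (d := θ.D) θ.L) :=
  prop10Printed_G_local θ.L θ.toStage1Params.two_le_L

/-- **THE TYPED LEAF AT THE LOCAL CARRIERS, at the record's parameters**: `B7.Concl` with the record's constants `(L, cB d L, C0 d, c2' d L)` at the five local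
families (`B7Prop8to10Local.concl_local` by name) — every small-field ∕ regularity hypothesis of Props. 1–10 read on the box print names.  The node statement of
record reads the GLOBAL carriers `Node00.carriers₂ θ X`; this is the located item (g1) of its reading, in kernel form, complete.
[cite: Balaban1985Averaging, Props. 1–10 pp.26–50, p.24 (locality)] -/
theorem N04_concl_local :
    B7.Concl (θ.L : ℝ) (cB θ.D θ.L) (C0 θ.D) (c2' θ.D θ.L)
      (concreteOneStepLocalUnion θ.𝔸 (d := θ.D) θ.L)
      (concreteKStepLocal θ.D θ.𝔸 (unitaryUnits θ.𝔸) θ.L)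
      (concreteKExpLocal θ.𝔸 (unitaryUnits θ.𝔸) (d := θ.D) θ.L)
      (concreteGaugeDataLocal θ.𝔸 (d := θ.D) θ.L)
      (concreteGaugeOneStepLocal θ.𝔸 (d := θ.D) θ.L) :=
  concl_local θ.D θ.L θ.toStage1Params.two_le_L θ.𝔸

end LocalLegsGauge

end Literature.MathematicalPhysics.QuantumFieldTheory.Balaban1983to89.Node00

end
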